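import Mathlib
import HarnessLib

/-!
# The Metropolized non-equilibrium switch (NCMC) on a general state space: a Crooks pair is all it needs

HONEST FRAMING: exact (Metropolis-corrected) sampling algorithms for lattice gauge theory;
figures of merit are autocorrelation/cost numbers at stated couplings and volumes; no
continuum-physics claim.

Venture `LatticeQCDFlow` (cell pub-lqcd), topic `Exactness`; FANOUT row 13 (`eng-snf`, GEN-9).
NEW WORK of the cell (general measure theory, elementary), not a published result; nothing is
cited as a fact.  Printed counterparts, named only: G. E. Crooks, J. Stat. Phys. 90 (1998) 1481 /
Phys. Rev. E 61 (2000) 2361 (pathwise fluctuation theorem); J. P. Nilmeier, G. E. Crooks,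
D. D. L. Minh, J. D. Chodera, PNAS 108 (2011) E1009 (NCMC); Bonanno et al. arXiv:2510.25704 §2
(NE-MCMC with defects / stochastic normalizing flows for SU(3)).

WHY.  `Exactness/NCMCExpandedEnsemble.lean` (+ `…Kernel`, `…SNF`) type the `ncmc-metropolis`
mode of `latflow-snf` (≥ 0.1.9) on a FINITE configuration space.  The engine's state space is
`SU(N)^{edges}` with Haar measure, its protocol steps are heat-bath / over-relaxation sweeps and
their adjoints, and its stout-defect coupling layers carry Jacobians.  THIS file is the
general-state-space statement (row 9's reading rule for the typed-exactness map: "the state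
space the engine uses, not only finite toys"): measurable spaces, Mathlib `Kernel`s, σ-algebras —
and ONE hypothesis, the CROOKS PAIR, which isolates exactly what a protocol must certify.

## Setting and content

`Ω` the configuration space, `E` the space of EVOLUTION RECORDS (for an `n`-step protocol: paths;
kept abstract), un-normalised level weights `ν₀` (prior, e.g. `e^{-S_0}·vol`) and `ν₁` (target,
`e^{-S_n}·vol`) on `Ω`; a forward record kernel `κF : Kernel Ω E` (run the protocol up from a prior
state), a reverse record kernel `κR : Kernel Ω E` (run the adjoint protocol down from a target
state), start / end maps `s e : E → Ω`, the work `W : E → ℝ`.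

* `CrooksPair ν₀ ν₁ κF κR s e W` — a HYPOTHESIS structure (like `FlowPushforward.HasJacobian`;
  nothing is cited): (i) `κF x`-a.s. the record starts at `x`, (ii) `κR y`-a.s. it ends at `y`,
  (iii) CROOKS' IDENTITY AS AN EQUALITY OF MEASURES ON RECORDS: `e^{-W} · (ν₀ ∘ κF) = ν₁ ∘ κR`
  (`Measure.bind`, `Measure.withDensity`).  On a finite space this is
  `NCMCExpandedEnsemble.crooks_unnormalised`; in general it is what one stochastic step with its
  adjoint, one bijective layer with its Jacobian, and their concatenations deliver (instances are
  the business of the protocol, not of the sampler).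
* `accF c W = min 1 e^{-(W − c)}`, `accR c W = min 1 e^{W − c}` and the pointwise tilt
  `e^{-W} · (e^{c} · accR) = accF` (`exp_neg_mul_accR`);
* `fwdFlow` / `revFlow` — accepted one-switch flows `F_c(x, B) = ∫ accF · 1_B(e) dκF x`,
  `R_c(y, A) = ∫ accR · 1_A(s) dκR y`;
* **`CrooksPair.levelBalance`** — DETAILED BALANCE BETWEEN THE LEVELS, for every `c` and all
  measurable `A, B ⊆ Ω`:  `∫_A F_c(x, B) dν₀(x) = e^{c} ∫_B R_c(y, A) dν₁(y)`.
  This is the whole content of exactness: with it the expanded-ensemble switch kernel on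
  `Bool × Ω` (accepted moves between the levels, rejected mass on the diagonal) is reversible for
  `Π_c = ν₀ ⊗ δ_prior + e^{c} ν₁ ⊗ δ_target` and leaves it invariant — packaged as a Mathlib
  `Kernel` with `Kernel.IsReversible` / `Kernel.Invariant` in `Exactness/NCMCGeneralSpaceKernel.lean`;
  here the invariance is stated in flow form (`CrooksPair.targetLevel_invariant`,
  `CrooksPair.priorLevel_invariant`: flow in = flow out for every measurable set of either level).

Nothing is assumed about `c`, about normalisability of `ν₀, ν₁`, or about reversibility of the
protocol steps; `κF, κR` are Markov kernels.
-/

namespace Summit.Ventures.LatticeQCDFlow.Exactness.GeneralNCMC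

open MeasureTheory ProbabilityTheory Set
open scoped ENNReal

variable {Ω E : Type*} [MeasurableSpace Ω] [MeasurableSpace E]

/-! ## Crooks pairs -/

/-- **Crooks pair.**  Forward / reverse record kernels `κF, κR`, start / end maps `s, e`, work `W`,
between the un-normalised level weights `ν₀` (prior) and `ν₁` (target): records drawn from `κF x`
start at `x`, records drawn from `κR y` end at `y`, and CROOKS' identity holds as an equality of
measures on records, `e^{-W} · (ν₀ ∘ κF) = ν₁ ∘ κR`. -/
structure CrooksPair (ν₀ ν₁ : Measure Ω) (κF κR : Kernel Ω E) (s e : E → Ω) (W : E → ℝ) :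
    Prop where
  measurable_s : Measurable s
  measurable_e : Measurable e
  measurable_W : Measurable W
  start_ae : ∀ x, ∀ᵐ ε ∂(κF x), s ε = x
  end_ae : ∀ y, ∀ᵐ ε ∂(κR y), e ε = y
  crooks : (ν₀.bind κF).withDensity (fun ε => ENNReal.ofReal (Real.exp (-W ε))) = ν₁.bind κR

/-! ## Acceptances and accepted flows -/

/-- Forward Metropolis acceptance against the constant `c`: `min 1 e^{-(W − c)}`. -/
noncomputable def accF (c : ℝ) (W : E → ℝ) (ε : E) : ℝ≥0∞ :=
  ENNReal.ofReal (min 1 (Real.exp (-(W ε - c))))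

/-- Reverse Metropolis acceptance (reverse work `−W`): `min 1 e^{W − c}`. -/
noncomputable def accR (c : ℝ) (W : E → ℝ) (ε : E) : ℝ≥0∞ :=
  ENNReal.ofReal (min 1 (Real.exp (W ε - c)))

omit [MeasurableSpace E] in
/-- The forward acceptance is a probability. -/
theorem accF_le_one (c : ℝ) (W : E → ℝ) (ε : E) : accF c W ε ≤ 1 := by
  unfold accF
  rw [← ENNReal.ofReal_one]
  exact ENNReal.ofReal_le_ofReal (min_le_left _ _)

omit [MeasurableSpace E] in
/-- The reverse acceptance is a probability. -/
theorem accR_le_one (c : ℝ) (W : E → ℝ) (ε : E) : accR c W ε ≤ 1 := by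
  unfold accR
  rw [← ENNReal.ofReal_one]
  exact ENNReal.ofReal_le_ofReal (min_le_left _ _)

/-- Measurability of the forward acceptance. -/
theorem measurable_accF (c : ℝ) {W : E → ℝ} (hW : Measurable W) : Measurable (accF c W) :=
  (measurable_const.min (Real.measurable_exp.comp (hW.sub measurable_const).neg)).ennreal_ofReal

/-- Measurability of the reverse acceptance. -/
theorem measurable_accR (c : ℝ) {W : E → ℝ} (hW : Measurable W) : Measurable (accR c W) :=
  (measurable_const.min (Real.measurable_exp.comp (hW.sub measurable_const))).ennreal_ofReal

omit [MeasurableSpace E] in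
/-- **Crooks' tilt of the acceptances**: `e^{-W} · (e^{c} · min 1 e^{W − c}) = min 1 e^{-(W − c)}`. -/
theorem exp_neg_mul_accR (c : ℝ) (W : E → ℝ) (ε : E) :
    ENNReal.ofReal (Real.exp (-W ε)) * (ENNReal.ofReal (Real.exp c) * accR c W ε) = accF c W ε := by
  unfold accR accF
  rw [← ENNReal.ofReal_mul (Real.exp_pos c).le, ← ENNReal.ofReal_mul (Real.exp_pos _).le]
  congr 1
  rw [mul_min_of_nonneg _ _ (Real.exp_pos c).le, mul_one, ← Real.exp_add,
    mul_min_of_nonneg _ _ (Real.exp_pos _).le, ← Real.exp_add, ← Real.exp_add]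
  rw [show -W ε + (c + (W ε - c)) = 0 by ring, Real.exp_zero, show -W ε + c = -(W ε - c) by ring,
    min_comm]

/-- Accepted forward flow from the prior state `x` into the target set `B`:
`F_c(x, B) = ∫ accF · 1_B(end) dκF x`. -/
noncomputable def fwdFlow (κF : Kernel Ω E) (c : ℝ) (W : E → ℝ) (e : E → Ω) (x : Ω) (B : Set Ω) :
    ℝ≥0∞ :=
  ∫⁻ ε, accF c W ε * B.indicator 1 (e ε) ∂(κF x)

/-- Accepted reverse flow from the target state `y` into the prior set `A`:
`R_c(y, A) = ∫ accR · 1_A(start) dκR y`. -/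
noncomputable def revFlow (κR : Kernel Ω E) (c : ℝ) (W : E → ℝ) (s : E → Ω) (y : Ω) (A : Set Ω) :
    ℝ≥0∞ :=
  ∫⁻ ε, accR c W ε * A.indicator 1 (s ε) ∂(κR y)

/-- Forward acceptance mass `F_c(x, Ω) = ∫ accF dκF x`. -/
theorem fwdFlow_univ (κF : Kernel Ω E) (c : ℝ) (W : E → ℝ) (e : E → Ω) (x : Ω) :
    fwdFlow κF c W e x univ = ∫⁻ ε, accF c W ε ∂(κF x) := by
  simp [fwdFlow]

/-- Reverse acceptance mass `R_c(y, Ω) = ∫ accR dκR y`. -/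
theorem revFlow_univ (κR : Kernel Ω E) (c : ℝ) (W : E → ℝ) (s : E → Ω) (y : Ω) :
    revFlow κR c W s y univ = ∫⁻ ε, accR c W ε ∂(κR y) := by
  simp [revFlow]

/-- The accepted forward flow is at most one (Markov record kernel). -/
theorem fwdFlow_le_one (κF : Kernel Ω E) [IsMarkovKernel κF] (c : ℝ) (W : E → ℝ) (e : E → Ω)
    (x : Ω) (B : Set Ω) : fwdFlow κF c W e x B ≤ 1 := by
  unfold fwdFlow
  calc ∫⁻ ε, accF c W ε * B.indicator 1 (e ε) ∂(κF x) ≤ ∫⁻ _, 1 ∂(κF x) :=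
        lintegral_mono fun ε => by
          calc accF c W ε * B.indicator 1 (e ε) ≤ 1 * 1 :=
                mul_le_mul' (accF_le_one c W ε) (Set.indicator_le_self' (fun _ _ => zero_le_one) _)
            _ = 1 := one_mul 1
    _ = 1 := by rw [lintegral_const, measure_univ, mul_one]

/-- The accepted reverse flow is at most one (Markov record kernel). -/
theorem revFlow_le_one (κR : Kernel Ω E) [IsMarkovKernel κR] (c : ℝ) (W : E → ℝ) (s : E → Ω)
    (y : Ω) (A : Set Ω) : revFlow κR c W s y A ≤ 1 := by
  unfold revFlow
  calc ∫⁻ ε, accR c W ε * A.indicator 1 (s ε) ∂(κR y) ≤ ∫⁻ _, 1 ∂(κR y) :=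
        lintegral_mono fun ε => by
          calc accR c W ε * A.indicator 1 (s ε) ≤ 1 * 1 :=
                mul_le_mul' (accR_le_one c W ε) (Set.indicator_le_self' (fun _ _ => zero_le_one) _)
            _ = 1 := one_mul 1
    _ = 1 := by rw [lintegral_const, measure_univ, mul_one]

/-- The accepted forward flow into a measurable set is measurable in the start point. -/
theorem measurable_fwdFlow (κF : Kernel Ω E) (c : ℝ) {W : E → ℝ} (hW : Measurable W) {e : E → Ω}
    (he : Measurable e) {B : Set Ω} (hB : MeasurableSet B) :
    Measurable fun x => fwdFlow κF c W e x B := by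
  unfold fwdFlow
  exact ((measurable_accF c hW).mul ((measurable_one.indicator hB).comp he)).lintegral_kernel

/-- The accepted reverse flow into a measurable set is measurable in the end point. -/
theorem measurable_revFlow (κR : Kernel Ω E) (c : ℝ) {W : E → ℝ} (hW : Measurable W) {s : E → Ω}
    (hs : Measurable s) {A : Set Ω} (hA : MeasurableSet A) :
    Measurable fun y => revFlow κR c W s y A := by
  unfold revFlow
  exact ((measurable_accR c hW).mul ((measurable_one.indicator hA).comp hs)).lintegral_kernel

/-! ## Detailed balance between the levels -/

namespace CrooksPair

variable {ν₀ ν₁ : Measure Ω} {κF κR : Kernel Ω E} {s e : E → Ω} {W : E → ℝ}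

/-- Pulling a start indicator inside the forward record integral (`κF x`-a.s. `s = x`). -/
theorem indicator_mul_lintegral_fwd (h : CrooksPair ν₀ ν₁ κF κR s e W) (A : Set Ω)
    (g : E → ℝ≥0∞) (x : Ω) :
    A.indicator 1 x * ∫⁻ ε, g ε ∂(κF x) = ∫⁻ ε, A.indicator 1 (s ε) * g ε ∂(κF x) := by
  by_cases hx : x ∈ A
  · rw [indicator_of_mem hx, Pi.one_apply, one_mul]
    refine lintegral_congr_ae ((h.start_ae x).mono fun ε hε => ?_)
    change g ε = A.indicator 1 (s ε) * g ε
    rw [hε, indicator_of_mem hx, Pi.one_apply, one_mul]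
  · rw [indicator_of_notMem hx, zero_mul]
    refine Eq.symm ((lintegral_congr_ae ((h.start_ae x).mono fun ε hε => ?_)).trans lintegral_zero)
    rw [hε, indicator_of_notMem hx, zero_mul]

/-- Pulling an end indicator inside the reverse record integral (`κR y`-a.s. `e = y`). -/
theorem indicator_mul_lintegral_rev (h : CrooksPair ν₀ ν₁ κF κR s e W) (B : Set Ω)
    (g : E → ℝ≥0∞) (y : Ω) :
    B.indicator 1 y * ∫⁻ ε, g ε ∂(κR y) = ∫⁻ ε, B.indicator 1 (e ε) * g ε ∂(κR y) := by
  by_cases hy : y ∈ B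
  · rw [indicator_of_mem hy, Pi.one_apply, one_mul]
    refine lintegral_congr_ae ((h.end_ae y).mono fun ε hε => ?_)
    change g ε = B.indicator 1 (e ε) * g ε
    rw [hε, indicator_of_mem hy, Pi.one_apply, one_mul]
  · rw [indicator_of_notMem hy, zero_mul]
    refine Eq.symm ((lintegral_congr_ae ((h.end_ae y).mono fun ε hε => ?_)).trans lintegral_zero)
    rw [hε, indicator_of_notMem hy, zero_mul]

/-- Restricted integrals as indicator-weighted integrals (bookkeeping). -/
theorem setLIntegral_eq_indicator_mul (μ : Measure Ω) {A : Set Ω} (hA : MeasurableSet A)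
    (F : Ω → ℝ≥0∞) : ∫⁻ x in A, F x ∂μ = ∫⁻ x, A.indicator 1 x * F x ∂μ := by
  rw [← lintegral_indicator hA]
  refine lintegral_congr fun x => ?_
  by_cases hx : x ∈ A
  · rw [indicator_of_mem hx, indicator_of_mem hx, Pi.one_apply, one_mul]
  · rw [indicator_of_notMem hx, indicator_of_notMem hx, zero_mul]

/-- **Detailed balance between the levels.**  For a Crooks pair, every `c` and all measurable
`A, B ⊆ Ω`: the `ν₀`-weighted accepted forward flow from `A` into `B` equals `e^{c}` times the
`ν₁`-weighted accepted reverse flow from `B` into `A`,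
`∫_A F_c(x, B) dν₀ = e^{c} ∫_B R_c(y, A) dν₁`.  (Crooks' identity moves the integral from forward
records to reverse records; the tilt `e^{-W} e^{c} min(1, e^{W−c}) = min(1, e^{-(W−c)})` matches the
two Metropolis factors; the a.s. start / end properties place the indicators.) -/
theorem levelBalance (h : CrooksPair ν₀ ν₁ κF κR s e W) (c : ℝ) {A B : Set Ω}
    (hA : MeasurableSet A) (hB : MeasurableSet B) :
    ∫⁻ x in A, fwdFlow κF c W e x B ∂ν₀ =
      ENNReal.ofReal (Real.exp c) * ∫⁻ y in B, revFlow κR c W s y A ∂ν₁ := by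
  have hacF := measurable_accF c h.measurable_W
  have hacR := measurable_accR c h.measurable_W
  have hiA : Measurable fun ε => A.indicator (1 : Ω → ℝ≥0∞) (s ε) :=
    (measurable_one.indicator hA).comp h.measurable_s
  have hiB : Measurable fun ε => B.indicator (1 : Ω → ℝ≥0∞) (e ε) :=
    (measurable_one.indicator hB).comp h.measurable_e
  have hexp : Measurable fun ε => ENNReal.ofReal (Real.exp (-W ε)) :=
    (Real.measurable_exp.comp h.measurable_W.neg).ennreal_ofReal
  -- the integrand on records, before (`G`) and after (`G'`) Crooks' tilt
  set G : E → ℝ≥0∞ := fun ε => A.indicator 1 (s ε) * (accF c W ε * B.indicator 1 (e ε)) with hG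
  set G' : E → ℝ≥0∞ := fun ε =>
    A.indicator 1 (s ε) * (ENNReal.ofReal (Real.exp c) * accR c W ε * B.indicator 1 (e ε)) with hG'
  have hGm : Measurable G := hiA.mul (hacF.mul hiB)
  have hG'm : Measurable G' := hiA.mul ((measurable_const.mul hacR).mul hiB)
  have hGG' : G = (fun ε => ENNReal.ofReal (Real.exp (-W ε))) * G' := by
    funext ε
    simp only [hG, hG', Pi.mul_apply]
    rw [← exp_neg_mul_accR c W ε]
    ring
  have hRm : Measurable fun y => revFlow κR c W s y A := measurable_revFlow κR c h.measurable_W h.measurable_s hA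
  calc ∫⁻ x in A, fwdFlow κF c W e x B ∂ν₀
      = ∫⁻ x, A.indicator 1 x * fwdFlow κF c W e x B ∂ν₀ := setLIntegral_eq_indicator_mul ν₀ hA _
    _ = ∫⁻ x, ∫⁻ ε, G ε ∂(κF x) ∂ν₀ :=
        lintegral_congr fun x => h.indicator_mul_lintegral_fwd A _ x
    _ = ∫⁻ ε, G ε ∂(ν₀.bind κF) :=
        (Measure.lintegral_bind κF.aemeasurable hGm.aemeasurable).symm
    _ = ∫⁻ ε, G' ε ∂((ν₀.bind κF).withDensity fun ε => ENNReal.ofReal (Real.exp (-W ε))) := by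
        rw [lintegral_withDensity_eq_lintegral_mul _ hexp hG'm, hGG']
    _ = ∫⁻ ε, G' ε ∂(ν₁.bind κR) := by rw [h.crooks]
    _ = ∫⁻ y, ∫⁻ ε, G' ε ∂(κR y) ∂ν₁ := Measure.lintegral_bind κR.aemeasurable hG'm.aemeasurable
    _ = ∫⁻ y, B.indicator 1 y * (ENNReal.ofReal (Real.exp c) * revFlow κR c W s y A) ∂ν₁ := by
        refine lintegral_congr fun y => ?_
        have hm : Measurable fun ε => accR c W ε * A.indicator 1 (s ε) := hacR.mul hiA
        rw [revFlow, ← lintegral_const_mul _ hm, h.indicator_mul_lintegral_rev B _ y]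
        refine lintegral_congr fun ε => ?_
        simp only [hG']
        ring
    _ = ∫⁻ y, ENNReal.ofReal (Real.exp c) * B.indicator (fun y => revFlow κR c W s y A) y ∂ν₁ := by
        refine lintegral_congr fun y => ?_
        by_cases hy : y ∈ B
        · rw [indicator_of_mem hy, indicator_of_mem hy, Pi.one_apply, one_mul]
        · rw [indicator_of_notMem hy, indicator_of_notMem hy, zero_mul, mul_zero]
    _ = ENNReal.ofReal (Real.exp c) * ∫⁻ y in B, revFlow κR c W s y A ∂ν₁ := by
        rw [lintegral_const_mul _ (hRm.indicator hB), lintegral_indicator hB]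

/-- **The target level is balanced** (flow form of invariance): for every measurable `B`, the
accepted flow into `B` from the prior level plus the mass that stays in `B` after a rejected
reverse switch is the target weight of `B`:
`∫ F_c(x, B) dν₀ + e^{c} ∫_B (1 − R_c(y, Ω)) dν₁ = e^{c} ν₁(B)`. -/
theorem targetLevel_invariant [IsMarkovKernel κR] (h : CrooksPair ν₀ ν₁ κF κR s e W) (c : ℝ)
    {B : Set Ω} (hB : MeasurableSet B) :
    ∫⁻ x, fwdFlow κF c W e x B ∂ν₀ +
        ENNReal.ofReal (Real.exp c) * ∫⁻ y in B, (1 - revFlow κR c W s y univ) ∂ν₁ =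
      ENNReal.ofReal (Real.exp c) * ν₁ B := by
  have hbal := h.levelBalance c MeasurableSet.univ hB
  rw [Measure.restrict_univ] at hbal
  have hRm : Measurable fun y => revFlow κR c W s y univ :=
    measurable_revFlow κR c h.measurable_W h.measurable_s MeasurableSet.univ
  rw [hbal, ← mul_add, ← lintegral_add_left hRm]
  congr 1
  calc ∫⁻ y in B, revFlow κR c W s y univ + (1 - revFlow κR c W s y univ) ∂ν₁
      = ∫⁻ _ in B, 1 ∂ν₁ :=
        lintegral_congr fun y => add_tsub_cancel_of_le (revFlow_le_one κR c W s y univ)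
    _ = ν₁ B := by rw [setLIntegral_const, one_mul]

/-- **The prior level is balanced**: for every measurable `A`,
`e^{c} ∫ R_c(y, A) dν₁ + ∫_A (1 − F_c(x, Ω)) dν₀ = ν₀(A)`. -/
theorem priorLevel_invariant [IsMarkovKernel κF] (h : CrooksPair ν₀ ν₁ κF κR s e W) (c : ℝ)
    {A : Set Ω} (hA : MeasurableSet A) :
    ENNReal.ofReal (Real.exp c) * ∫⁻ y, revFlow κR c W s y A ∂ν₁ +
        ∫⁻ x in A, (1 - fwdFlow κF c W e x univ) ∂ν₀ = ν₀ A := by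
  have hbal := h.levelBalance c hA MeasurableSet.univ
  rw [Measure.restrict_univ] at hbal
  have hFm : Measurable fun x => fwdFlow κF c W e x univ :=
    measurable_fwdFlow κF c h.measurable_W h.measurable_e MeasurableSet.univ
  rw [← hbal, ← lintegral_add_left hFm]
  calc ∫⁻ x in A, fwdFlow κF c W e x univ + (1 - fwdFlow κF c W e x univ) ∂ν₀
      = ∫⁻ _ in A, 1 ∂ν₀ :=
        lintegral_congr fun x => add_tsub_cancel_of_le (fwdFlow_le_one κF c W e x univ)
    _ = ν₀ A := by rw [setLIntegral_const, one_mul]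

end CrooksPair

end Summit.Ventures.LatticeQCDFlow.Exactness.GeneralNCMC
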